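import Summits.CriticalPhenomena.PercolationContinuityZ3.Theorems.SahiMasterFamilyFCombOneSharedDict

/-!
# SCHEME Σ: the row Kleitman–Hall classes (S7), (S8) of `φ` (support file)

Support file (prover seat `prim-bnk-2`, gen 31–32; `--supports stmt-CriticalPhenomena-4575`).  Proof document
`run/shared/lean/prim/prim-l12/prim-bnk-2/PROOF-THEOREM-I1.md` §2 (✓adm) and §3 (injectivity).

Row sources keep `x` and enlarge `y`: (S7) a `T3⁻` unit `((x, y), 2)` with `e ∈ x` has `y_J ∈ L(C⁰|_{J \ x_J})` and goes
to the `T3⁺` unit at `(x, y_I ∪ h₀(y_J))` (row Kleitman–Hall); (S8) a `T3⁻` unit with `e ∉ x` and `z_I ∈ B⁰|_R` goes, by the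
Kleitman–Hall bijection of the row family `C′ = {t ⊆ (J \ x_J) + e : t ∈ C}` applied to `ỹ = y \ I`, to the `T3⁺` unit at
`(x, y_I ∪ h_full(ỹ))`.  For each class: domain, value of `φ`, the class of the new trace, admissibility, signature (`10`, `11`)
and injectivity on the class (the row is that of the target; the bijection is injective).  No definitions; no `sorry`.
-/

namespace Summit.CriticalPhenomena.PercolationContinuityZ3.Theorems

namespace SahiFComb.Shift

open Finset FinsetFamily
open scoped Classical

variable {ι : Type*} [Fintype ι] [DecidableEq ι] [LinearOrder ι]

namespace OneShared

variable {S : OneShared ι}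

omit [LinearOrder ι] [Fintype ι] in
/-- A finset is determined by its trace on `K` and its part outside `K`. [folklore] -/
theorem eq_of_inter_eq_of_sdiff_eq {s t K : Finset ι} (h1 : s ∩ K = t ∩ K) (h2 : s \ K = t \ K) : s = t := by
  rw [← sdiff_union_inter s K, h1, h2, sdiff_union_inter]

/-! ### Class (S7): `T3⁻` with `e ∈ x` -/

/-- (S7) domain: `y_J ∈ σP \ P` for the row family `P = C⁰|_{J \ x_J}`. [this work] -/
theorem dom_S7 {x y : Finset ι} (hu : ((x, y), 2) ∈ ThreePartition.negUnitSetF S.B S.C) (hex : S.e ∈ x) :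
    y ∩ S.J ∈ (secLow (S.J \ (x ∩ S.J)) S.C).image (fun t => (S.J \ (x ∩ S.J)) \ t) \ secLow (S.J \ (x ∩ S.J)) S.C := by
  rw [mem_negUnitSetF_iff] at hu
  obtain ⟨hxy, h⟩ := hu
  simp only at hxy h
  rcases h with ⟨h0, -⟩ | ⟨h1, -⟩ | ⟨-, ⟨-, hzC⟩, hyC⟩
  · exact absurd h0 (by norm_num)
  · exact absurd h1 (by norm_num)
  have hey : S.e ∉ y := fun h => disjoint_left.1 hxy hex h
  have hez : S.e ∉ (x ∪ y)ᶜ := by rw [mem_compl, not_not, mem_union]; exact Or.inl hex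
  have hyJR : y ∩ S.J ⊆ S.J \ (x ∩ S.J) := inter_subset_sdiff_inter hxy.symm S.J
  have hzJ : (x ∪ y)ᶜ ∩ S.J = (S.J \ (x ∩ S.J)) \ (y ∩ S.J) := compl_union_inter_eq' x y S.J
  have hPR : ∀ s ∈ secLow (S.J \ (x ∩ S.J)) S.C, s ⊆ S.J \ (x ∩ S.J) := fun s hs => (mem_secLow.1 hs).1
  rw [mem_sdiff, mem_image_ground_sdiff _ hPR]
  refine ⟨⟨hyJR, ?_⟩, fun h => hyC ((mem_C_iff_secLow hey hyJR).2 h)⟩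
  rw [← hzJ]
  exact (mem_C_iff_secLow hez (hzJ ▸ sdiff_subset)).1 hzC

/-- (S7) the value of `φ`. [this work] -/
theorem phi_eq_S7 {x y : Finset ι} (hu : ((x, y), 2) ∈ ThreePartition.negUnitSetF S.B S.C) (hex : S.e ∈ x) :
    S.phi ((x, y), 2) = ((x, (y \ S.J) ∪ ((S.dataJ (x ∩ S.J)).g₀ ⟨y ∩ S.J, dom_S7 hu hex⟩ : Finset ι)), 2) := by
  unfold OneShared.phi
  simp only [hex, if_true, if_false, show ((2 : ℕ) = 0) = False by simp, show ((2 : ℕ) = 1) = False by simp]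
  rw [dif_pos (dom_S7 hu hex)]

/-- (S7) the new `J`-trace `g = h₀(y_J)` lies in `H(P)`: `g ⊆ J \ x_J`, `g ∈ C`, `σ g ∉ P`. [this work] -/
theorem img_S7 {x y : Finset ι} (hu : ((x, y), 2) ∈ ThreePartition.negUnitSetF S.B S.C) (hex : S.e ∈ x) :
    ((S.dataJ (x ∩ S.J)).g₀ ⟨y ∩ S.J, dom_S7 hu hex⟩ : Finset ι) ⊆ S.J \ (x ∩ S.J) ∧
      ((S.dataJ (x ∩ S.J)).g₀ ⟨y ∩ S.J, dom_S7 hu hex⟩ : Finset ι) ∈ S.C ∧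
      (S.J \ (x ∩ S.J)) \ ((S.dataJ (x ∩ S.J)).g₀ ⟨y ∩ S.J, dom_S7 hu hex⟩ : Finset ι) ∉ secLow (S.J \ (x ∩ S.J)) S.C := by
  have hPR : ∀ s ∈ secLow (S.J \ (x ∩ S.J)) S.C, s ⊆ S.J \ (x ∩ S.J) := fun s hs => (mem_secLow.1 hs).1
  have hgmem := ((S.dataJ (x ∩ S.J)).g₀ ⟨y ∩ S.J, dom_S7 hu hex⟩).2
  rw [mem_sdiff, mem_image_ground_sdiff _ hPR, mem_secLow] at hgmem
  obtain ⟨⟨hgR, hgC⟩, hgn⟩ := hgmem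
  exact ⟨hgR, hgC, fun h => hgn ⟨hgR, h⟩⟩

/-- **Class (S7)**: a `T3⁻` unit with `e ∈ x` goes to the `T3⁺` unit at `(x, y_I ∪ h₀(y_J))` (row Kleitman–Hall for `C⁰`
on the cube `J \ x_J`). [this work] -/
theorem phi_adm_S7 {x y : Finset ι} (hu : ((x, y), 2) ∈ ThreePartition.negUnitSetF S.B S.C) (hex : S.e ∈ x) :
    S.phi ((x, y), 2) ∈ ThreePartition.posUnitSetF S.B S.C ∧ x ⊆ (S.phi ((x, y), 2)).1.1 ∧ y ⊆ (S.phi ((x, y), 2)).1.2 := by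
  obtain ⟨hgR, hgC, hgn⟩ := img_S7 hu hex
  have hgdom : y ∩ S.J ⊆ ((S.dataJ (x ∩ S.J)).g₀ ⟨y ∩ S.J, dom_S7 hu hex⟩ : Finset ι) :=
    (S.dataJ (x ∩ S.J)).hg₀ ⟨y ∩ S.J, dom_S7 hu hex⟩
  rw [phi_eq_S7 hu hex]
  set g := ((S.dataJ (x ∩ S.J)).g₀ ⟨y ∩ S.J, dom_S7 hu hex⟩ : Finset ι) with hg
  rw [mem_negUnitSetF_iff] at hu
  obtain ⟨hxy, h⟩ := hu
  simp only at hxy h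
  rcases h with ⟨h0, -⟩ | ⟨h1, -⟩ | ⟨-, ⟨hzB, -⟩, -⟩
  · exact absurd h0 (by norm_num)
  · exact absurd h1 (by norm_num)
  have hey : S.e ∉ y := fun h => disjoint_left.1 hxy hex h
  have hez : S.e ∉ (x ∪ y)ᶜ := by rw [mem_compl, not_not, mem_union]; exact Or.inl hex
  have hgJ : g ⊆ S.J := hgR.trans sdiff_subset
  have hey' : S.e ∉ (y \ S.J) ∪ g := fun h => hey ((nf_mem_iff S.heJ hgJ).1 h)
  have hdisj' : Disjoint x ((y \ S.J) ∪ g) := (nf_disjoint hxy.symm hgR).symm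
  have hez' : S.e ∉ (x ∪ ((y \ S.J) ∪ g))ᶜ := by rw [mem_compl, not_not, mem_union]; exact Or.inl hex
  have hz'J : (x ∪ ((y \ S.J) ∪ g))ᶜ ∩ S.J = (S.J \ (x ∩ S.J)) \ g := nfy_compl_inter hgJ
  rw [mem_posUnitSetF_iff]
  refine ⟨⟨hdisj', Or.inr (Or.inr ⟨rfl, ⟨?_, ?_⟩, ?_⟩)⟩, subset_rfl, nf_subset hgdom⟩
  · -- `z' ∈ B`: same `I`-trace as `z`, `e` in neither
    refine (memB_congr (s := (x ∪ y)ᶜ) ⟨fun h => absurd h hez, fun h => absurd h hez'⟩ ?_).1 hzB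
    rw [compl_union_inter_eq' x y S.I, compl_union_inter_eq', nf_inter_other S.hIJ.symm hgJ]
  · -- `z' ∉ C`
    intro hz'C
    have h1 := (mem_C_iff_secLow hez' (hz'J ▸ sdiff_subset)).1 hz'C
    rw [hz'J, mem_secLow] at h1
    exact hgn (mem_secLow.2 ⟨sdiff_subset, h1.2⟩)
  · -- `y' ∈ C`
    refine (mem_C_iff_secLow (R := S.J \ (x ∩ S.J)) hey' ?_).2 ?_
    · rw [nf_inter hgJ]; exact hgR
    · rw [nf_inter hgJ]; exact mem_secLow.2 ⟨hgR, hgC⟩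

/-- (S7) signature of the target: `10`. [this work] -/
theorem sig_phi_S7 {x y : Finset ι} (hu : ((x, y), 2) ∈ ThreePartition.negUnitSetF S.B S.C) (hex : S.e ∈ x) :
    S.sig (S.phi ((x, y), 2)) = 10 := by
  rw [phi_eq_S7 hu hex]
  exact S.sig_eq_10 rfl hex

/-- (S7) `φ` is injective on the class. [this work] -/
theorem inj_S7 {x₁ y₁ x₂ y₂ : Finset ι} (hu₁ : ((x₁, y₁), 2) ∈ ThreePartition.negUnitSetF S.B S.C) (hex₁ : S.e ∈ x₁)
    (hu₂ : ((x₂, y₂), 2) ∈ ThreePartition.negUnitSetF S.B S.C) (hex₂ : S.e ∈ x₂)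
    (h : S.phi ((x₁, y₁), 2) = S.phi ((x₂, y₂), 2)) : ((x₁, y₁), 2) = ((x₂, y₂), 2) := by
  rw [phi_eq_S7 hu₁ hex₁, phi_eq_S7 hu₂ hex₂] at h
  simp only [Prod.mk.injEq, and_true] at h
  obtain ⟨rfl, hy⟩ := h
  have hg₁J := (img_S7 hu₁ hex₁).1.trans sdiff_subset
  have hg₂J := (img_S7 hu₂ hex₂).1.trans sdiff_subset
  have hJ : y₁ ∩ S.J = y₂ ∩ S.J :=
    congrArg Subtype.val ((S.dataJ _).g₀.injective (Subtype.ext (nf_eq_nf_inter hg₁J hg₂J hy)))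
  have hI : y₁ ∩ S.I = y₂ ∩ S.I := nf_eq_nf_inter_other S.hIJ.symm hg₁J hg₂J hy
  have hey₁ : S.e ∉ y₁ := fun he => disjoint_left.1 ((mem_negUnitSetF_iff _ _ _).1 hu₁).1 hex₁ he
  have hey₂ : S.e ∉ y₂ := fun he => disjoint_left.1 ((mem_negUnitSetF_iff _ _ _).1 hu₂).1 hex₂ he
  rw [part_eq_of_traces (s := y₁) (s' := y₂) ⟨fun h => absurd h hey₁, fun h => absurd h hey₂⟩ hI hJ]

/-! ### Class (S8): `T3⁻`, `e ∉ x`, `z_I ∈ B⁰` -/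

/-- (S8) `ỹ = y \ I` lies in the row ground set `(J \ x_J) + e`. [this work] -/
theorem sdiff_I_subset_rowGround {x y : Finset ι} (hxy : Disjoint x y) : y \ S.I ⊆ insert S.e (S.J \ (x ∩ S.J)) := by
  intro i hi
  rw [mem_sdiff] at hi
  rcases S.hcov i with rfl | h | h
  · exact mem_insert_self _ _
  · exact absurd h hi.2
  · exact mem_insert_of_mem (mem_sdiff.2 ⟨h, fun hx => disjoint_left.1 hxy (mem_inter.1 hx).1 hi.1⟩)

/-- (S8) the `(J+e)`-trace of the third part of a face `(x, y')` with `e ∉ x` and `y' \ I = g`. [this work] -/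
theorem compl_inter_insert_J_eq {x y' g : Finset ι} (hex : S.e ∉ x) (hg : y' \ S.I = g) :
    (x ∪ y')ᶜ ∩ insert S.e S.J = insert S.e (S.J \ (x ∩ S.J)) \ g := by
  ext i
  simp only [mem_inter, mem_compl, mem_union, not_or, mem_insert, mem_sdiff, not_and]
  constructor
  · rintro ⟨⟨hix, hiy⟩, h⟩
    have hiI : i ∉ S.I := by
      rcases h with rfl | hJ
      · exact S.heI
      · exact fun hI => disjoint_left.1 S.hIJ hI hJ
    refine ⟨h.imp id (fun hJ => ⟨hJ, fun hx => absurd hx hix⟩), fun hig => hiy ?_⟩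
    have : i ∈ y' \ S.I := hg.symm ▸ hig
    exact (mem_sdiff.1 this).1
  · rintro ⟨h, hig⟩
    have hiI : i ∉ S.I := by
      rcases h with rfl | ⟨hJ, -⟩
      · exact S.heI
      · exact fun hI => disjoint_left.1 S.hIJ hI hJ
    refine ⟨⟨?_, fun hy => hig (hg ▸ mem_sdiff.2 ⟨hy, hiI⟩)⟩, h.imp id (fun h => h.1)⟩
    rcases h with rfl | ⟨hJ, hx⟩
    · exact hex
    · exact fun hix => hx hix hJ

/-- (S8) domain: `ỹ = y \ I ∈ σP′ \ P′` for the row family `P′ = secLow ((J \ x_J) + e) C`. [this work] -/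
theorem dom_S8 {x y : Finset ι} (hu : ((x, y), 2) ∈ ThreePartition.negUnitSetF S.B S.C) (hex : S.e ∉ x) :
    y \ S.I ∈ (secLow (insert S.e (S.J \ (x ∩ S.J))) S.C).image (fun t => insert S.e (S.J \ (x ∩ S.J)) \ t) \
      secLow (insert S.e (S.J \ (x ∩ S.J))) S.C := by
  rw [mem_negUnitSetF_iff] at hu
  obtain ⟨hxy, h⟩ := hu
  simp only at hxy h
  rcases h with ⟨h0, -⟩ | ⟨h1, -⟩ | ⟨-, ⟨-, hzC⟩, hyC⟩
  · exact absurd h0 (by norm_num)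
  · exact absurd h1 (by norm_num)
  set S' : Finset ι := insert S.e (S.J \ (x ∩ S.J)) with hS'
  have hyS' : y \ S.I ⊆ S' := sdiff_I_subset_rowGround hxy
  have hzS' : (x ∪ y)ᶜ ∩ insert S.e S.J = S' \ (y \ S.I) := compl_inter_insert_J_eq hex rfl
  have hP'R : ∀ s ∈ secLow S' S.C, s ⊆ S' := fun s hs => (mem_secLow.1 hs).1
  rw [mem_sdiff, mem_image_ground_sdiff _ hP'R]
  refine ⟨⟨hyS', mem_secLow.2 ⟨sdiff_subset, ?_⟩⟩, fun h => hyC ?_⟩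
  · rw [← hzS', ← S.hdepC]; exact hzC
  · rw [S.hdepC, inter_insert_J_eq_sdiff_I]; exact (mem_secLow.1 h).2

/-- (S8) the value of `φ`. [this work] -/
theorem phi_eq_S8 {x y : Finset ι} (hu : ((x, y), 2) ∈ ThreePartition.negUnitSetF S.B S.C) (hex : S.e ∉ x)
    (hzI : (S.I \ (y ∩ S.I)) \ (x ∩ S.I) ∈ secLow (S.I \ (y ∩ S.I)) S.B) :
    S.phi ((x, y), 2) = ((x, (y ∩ S.I) ∪ ((S.kh (x ∩ S.J)).g ⟨y \ S.I, dom_S8 hu hex⟩ : Finset ι)), 2) := by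
  unfold OneShared.phi
  simp only [hex, if_false, if_true, show ((2 : ℕ) = 0) = False by simp, show ((2 : ℕ) = 1) = False by simp, hzI]
  rw [dif_pos (dom_S8 hu hex)]

/-- (S8) the new trace `g = h_full(ỹ)` lies in `H(C′)`: `g ⊆ (J \ x_J) + e`, `g ∈ C`, `σ g ∉ C′`; `g` avoids `I`. [this work] -/
theorem img_S8 {x y : Finset ι} (hu : ((x, y), 2) ∈ ThreePartition.negUnitSetF S.B S.C) (hex : S.e ∉ x) :
    ((S.kh (x ∩ S.J)).g ⟨y \ S.I, dom_S8 hu hex⟩ : Finset ι) ⊆ insert S.e (S.J \ (x ∩ S.J)) ∧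
      ((S.kh (x ∩ S.J)).g ⟨y \ S.I, dom_S8 hu hex⟩ : Finset ι) ∈ S.C ∧
      insert S.e (S.J \ (x ∩ S.J)) \ ((S.kh (x ∩ S.J)).g ⟨y \ S.I, dom_S8 hu hex⟩ : Finset ι) ∉
        secLow (insert S.e (S.J \ (x ∩ S.J))) S.C ∧
      ∀ i ∈ ((S.kh (x ∩ S.J)).g ⟨y \ S.I, dom_S8 hu hex⟩ : Finset ι), i ∉ S.I := by
  have hP'R : ∀ s ∈ secLow (insert S.e (S.J \ (x ∩ S.J))) S.C, s ⊆ insert S.e (S.J \ (x ∩ S.J)) :=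
    fun s hs => (mem_secLow.1 hs).1
  have hgmem := ((S.kh (x ∩ S.J)).g ⟨y \ S.I, dom_S8 hu hex⟩).2
  rw [mem_sdiff, mem_image_ground_sdiff _ hP'R, mem_secLow] at hgmem
  obtain ⟨⟨hgS', hgC⟩, hgn⟩ := hgmem
  exact ⟨hgS', hgC, fun h => hgn ⟨hgS', h⟩, fun i hi => notMem_I_of_mem_rowGround (hgS' hi)⟩

/-- **Class (S8)**: a `T3⁻` unit with `e ∉ x` and `z_I ∈ B⁰|_R` goes to the `T3⁺` unit at `(x, y_I ∪ h_full(y \ I))`. [this work] -/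
theorem phi_adm_S8 {x y : Finset ι} (hu : ((x, y), 2) ∈ ThreePartition.negUnitSetF S.B S.C) (hex : S.e ∉ x)
    (hzI : (S.I \ (y ∩ S.I)) \ (x ∩ S.I) ∈ secLow (S.I \ (y ∩ S.I)) S.B) :
    S.phi ((x, y), 2) ∈ ThreePartition.posUnitSetF S.B S.C ∧ x ⊆ (S.phi ((x, y), 2)).1.1 ∧ y ⊆ (S.phi ((x, y), 2)).1.2 := by
  obtain ⟨hgS', hgC, hgn, hgI⟩ := img_S8 hu hex
  have hgdom : y \ S.I ⊆ ((S.kh (x ∩ S.J)).g ⟨y \ S.I, dom_S8 hu hex⟩ : Finset ι) :=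
    (S.kh (x ∩ S.J)).hg ⟨y \ S.I, dom_S8 hu hex⟩
  rw [phi_eq_S8 hu hex hzI]
  set g := ((S.kh (x ∩ S.J)).g ⟨y \ S.I, dom_S8 hu hex⟩ : Finset ι) with hg
  rw [mem_negUnitSetF_iff] at hu
  obtain ⟨hxy, -⟩ := hu
  simp only at hxy
  set S' : Finset ι := insert S.e (S.J \ (x ∩ S.J)) with hS'
  have hS'J : S' ⊆ insert S.e S.J := insert_subset_insert _ sdiff_subset
  -- the new face `(x, y')`, `y' = y_I ∪ g`
  have hdisj' : Disjoint x ((y ∩ S.I) ∪ g) := by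
    rw [disjoint_union_right]
    refine ⟨disjoint_of_subset_right inter_subset_left hxy, disjoint_left.2 fun i hix hig => ?_⟩
    rcases mem_insert.1 (hgS' hig) with rfl | h
    · exact hex hix
    · exact (mem_sdiff.1 h).2 (mem_inter.2 ⟨hix, (mem_sdiff.1 h).1⟩)
  have hy'J : ((y ∩ S.I) ∪ g) ∩ insert S.e S.J = g := by
    rw [inter_insert_J_eq_sdiff_I]; exact inter_union_sdiff_eq hgI
  have hy'I : ((y ∩ S.I) ∪ g) ∩ S.I = y ∩ S.I := inter_union_inter_eq hgI
  have hz'J : (x ∪ ((y ∩ S.I) ∪ g))ᶜ ∩ insert S.e S.J = S' \ g :=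
    compl_inter_insert_J_eq hex (inter_union_sdiff_eq hgI)
  rw [mem_posUnitSetF_iff]
  refine ⟨⟨hdisj', Or.inr (Or.inr ⟨rfl, ⟨?_, ?_⟩, ?_⟩)⟩, subset_rfl, ?_⟩
  · -- `z' ∈ B`: its `I`-trace is `z_I ∈ B⁰`, and `B` is up-closed
    have htr : (x ∪ ((y ∩ S.I) ∪ g))ᶜ ∩ S.I = (S.I \ (y ∩ S.I)) \ (x ∩ S.I) := by
      rw [compl_union_inter_eq, hy'I]
    rw [S.hdepB]
    refine S.hBup _ ?_ _ (inter_subset_inter subset_rfl (subset_insert S.e S.I)) (subset_univ _)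
    rw [htr]; exact (mem_secLow.1 hzI).2
  · -- `z' ∉ C`
    intro hz'C
    rw [S.hdepC, hz'J] at hz'C
    exact hgn (mem_secLow.2 ⟨sdiff_subset, hz'C⟩)
  · -- `y' ∈ C`
    rw [S.hdepC, hy'J]; exact hgC
  · -- `y ⊆ y'`
    intro i hi
    by_cases hiI : i ∈ S.I
    · exact mem_union_left _ (mem_inter.2 ⟨hi, hiI⟩)
    · exact mem_union_right _ (hgdom (mem_sdiff.2 ⟨hi, hiI⟩))

/-- (S8) signature of the target: `11`. [this work] -/
theorem sig_phi_S8 {x y : Finset ι} (hu : ((x, y), 2) ∈ ThreePartition.negUnitSetF S.B S.C) (hex : S.e ∉ x)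
    (hzI : (S.I \ (y ∩ S.I)) \ (x ∩ S.I) ∈ secLow (S.I \ (y ∩ S.I)) S.B) : S.sig (S.phi ((x, y), 2)) = 11 := by
  obtain ⟨-, -, -, hgI⟩ := img_S8 hu hex
  rw [phi_eq_S8 hu hex hzI]
  refine S.sig_eq_11 rfl hex ?_
  show (S.I \ (((y ∩ S.I) ∪ _) ∩ S.I)) \ (x ∩ S.I) ∈ secLow (S.I \ (((y ∩ S.I) ∪ _) ∩ S.I)) S.B
  rw [inter_union_inter_eq hgI]; exact hzI

/-- (S8) `φ` is injective on the class. [this work] -/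
theorem inj_S8 {x₁ y₁ x₂ y₂ : Finset ι} (hu₁ : ((x₁, y₁), 2) ∈ ThreePartition.negUnitSetF S.B S.C) (hex₁ : S.e ∉ x₁)
    (hzI₁ : (S.I \ (y₁ ∩ S.I)) \ (x₁ ∩ S.I) ∈ secLow (S.I \ (y₁ ∩ S.I)) S.B)
    (hu₂ : ((x₂, y₂), 2) ∈ ThreePartition.negUnitSetF S.B S.C) (hex₂ : S.e ∉ x₂)
    (hzI₂ : (S.I \ (y₂ ∩ S.I)) \ (x₂ ∩ S.I) ∈ secLow (S.I \ (y₂ ∩ S.I)) S.B)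
    (h : S.phi ((x₁, y₁), 2) = S.phi ((x₂, y₂), 2)) : ((x₁, y₁), 2) = ((x₂, y₂), 2) := by
  rw [phi_eq_S8 hu₁ hex₁ hzI₁, phi_eq_S8 hu₂ hex₂ hzI₂] at h
  simp only [Prod.mk.injEq, and_true] at h
  obtain ⟨rfl, hy⟩ := h
  have hg₁I := (img_S8 hu₁ hex₁).2.2.2
  have hg₂I := (img_S8 hu₂ hex₂).2.2.2
  have hI : y₁ ∩ S.I = y₂ ∩ S.I := by
    have h1 := congrArg (· ∩ S.I) hy
    simp only [inter_union_inter_eq hg₁I, inter_union_inter_eq hg₂I] at h1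
    exact h1
  have hD : y₁ \ S.I = y₂ \ S.I := by
    have h1 := congrArg (· \ S.I) hy
    simp only [inter_union_sdiff_eq hg₁I, inter_union_sdiff_eq hg₂I] at h1
    exact congrArg Subtype.val ((S.kh _).g.injective (Subtype.ext h1))
  rw [eq_of_inter_eq_of_sdiff_eq hI hD]

end OneShared

end SahiFComb.Shift

end Summit.CriticalPhenomena.PercolationContinuityZ3.Theorems
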